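import Summits.HubbardSuperconductivity.HubbardSuperconductivity.Theses.AnisotropyChord
import Literature.MathematicalPhysics.QuantumLattice.SpinChainsLiebMattisProofs
import Literature.MathematicalPhysics.QuantumLattice.FreeFermiGasPairGramBounds

/-!
# Route `AnisotropyChord`, crux `FerroSideChord` (stmt-HubbardSuperconductivity-19089):
# the order parameter is bounded by its ferromagnetic value — `Λ(ψ) ≤ S(S+1)` on the
# `S^z_tot = 0` sector (Tóth's maximality of the Dicke state), and the right-end slice
# `Δ₂ = 1` of the registered stub `stub_monotoneFM`

For spins `n/2` on a finite set `Λ` put `S = |Λ| n / 2` (the top weight).  On the magnetisation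
sector `S^z_tot = M` the operator `S⁺_tot S⁻_tot` satisfies
`Re⟨ψ, S⁺_tot S⁻_tot ψ⟩ ≤ (S(S+1) − M(M−1)) ‖ψ‖²` — the value on the top multiplet.  Proof by
downward induction on the weight using only the `su(2)` relations (`S⁺S⁻ = S⁻S⁺ + 2Sᶻ`,
`S⁺ : 𝓗_M → 𝓗_{M+1}`) and Cauchy–Schwarz (tree `norm_star_dotProduct_sq_le`): if `S⁺S⁻ ≤ c` on `𝓗_{M+1}` then for `ψ ∈ 𝓗_M`,
`‖S⁻S⁺ψ‖² = ⟨S⁺ψ, S⁺S⁻ S⁺ψ⟩ ≤ c ‖S⁺ψ‖² = c⟨ψ, S⁻S⁺ψ⟩ ≤ c‖ψ‖ ‖S⁻S⁺ψ‖`, so `⟨ψ, S⁻S⁺ψ⟩ ≤ c‖ψ‖²`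
and `⟨ψ, S⁺S⁻ψ⟩ ≤ (c + 2M)‖ψ‖²`; the top sector `𝓗_{S+1} = ⊥` starts the induction.

* `raiseLower_form_le` — the general bound (any `Λ`, `n`, weight `M = S − k`);
* `lambda_le_ferroValue` — on the `M × M` torus (`n = 1`, even `M`), sector `0`, unit `ψ`:
  `Re⟨ψ, S⁺_tot S⁻_tot ψ⟩ ≤ (M²/2)(M²/2 + 1)` = the exact ferromagnetic value of `FerroPointValue`
  (B. Tóth, Lett. Math. Phys. 28 (1993) 75: the Dicke state maximises `⟨B†B⟩` over the sector);
* `monotoneFM_right_end` — the slice `Δ₂ = 1` of the registered stub `stub_monotoneFM` of the line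
  `fm-monotone-anchor`: `Λ(ψ₁) ≤ Λ(ψ₂)` whenever `ψ₂` is a normalised sector ground state of the
  isotropic ferromagnet `H_M(1)`, given the route item `FerroPointValue` (PROVED in the tree,
  `ferroPointValue_proof`; taken by name as a hypothesis to keep this file's imports light).

H. Tasaki, *Physics and Mathematics of Quantum Many-Body Systems* (2020) §2.4, App. A.3; B. Tóth
(1993).  No definition is introduced.
-/

set_option linter.dupNamespace false

noncomputable section

open Matrix Complex Finset
open scoped ComplexOrder
open Literature.MathematicalPhysics.QuantumLattice Literature.Probability.LatticeModels
open Summit.HubbardSuperconductivity.HubbardSuperconductivity.Theses.AnisotropyChord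

namespace Summit.HubbardSuperconductivity.HubbardSuperconductivity.Theorems.AnisotropyChord.FerroSide

/-! ### Weight bounds -/

variable {Λ : Type*} [Fintype Λ] [DecidableEq Λ] (n : ℕ)

omit [DecidableEq Λ] in
/-- The magnetisation of a configuration is at most the top weight `|Λ| n / 2`. [folklore] -/
theorem mag_le_top (σ : TensorIndex Λ (n + 1)) : mag n σ ≤ (Fintype.card Λ : ℝ) * n / 2 := by
  unfold mag
  calc ∑ x, ((n : ℝ) / 2 - ((σ x : ℕ) : ℝ)) ≤ ∑ _x : Λ, (n : ℝ) / 2 :=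
        Finset.sum_le_sum fun x _ => by
          have : (0 : ℝ) ≤ ((σ x : ℕ) : ℝ) := Nat.cast_nonneg _
          linarith
    _ = (Fintype.card Λ : ℝ) * n / 2 := by
        rw [Finset.sum_const, Finset.card_univ, nsmul_eq_mul]; ring

omit [DecidableEq Λ] in
/-- The magnetisation of a configuration is at least `−|Λ| n / 2`. [folklore] -/
theorem neg_top_le_mag (σ : TensorIndex Λ (n + 1)) : -((Fintype.card Λ : ℝ) * n / 2) ≤ mag n σ := by
  unfold mag
  calc -((Fintype.card Λ : ℝ) * n / 2) = ∑ _x : Λ, (-((n : ℝ) / 2)) := by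
        rw [Finset.sum_const, Finset.card_univ, nsmul_eq_mul]; ring
    _ ≤ ∑ x, ((n : ℝ) / 2 - ((σ x : ℕ) : ℝ)) :=
        Finset.sum_le_sum fun x _ => by
          have h : ((σ x : ℕ) : ℝ) ≤ n := by exact_mod_cast Nat.lt_succ_iff.mp (σ x).isLt
          linarith

/-- Sectors above the top weight are trivial. [folklore] -/
theorem spinZSector_eq_bot_of_top_lt {M : ℝ} (hM : (Fintype.card Λ : ℝ) * n / 2 < M) :
    spinZSector (Λ := Λ) n M = ⊥ := by
  by_contra hne
  obtain ⟨σ, hσ⟩ := (spinZSector_ne_bot_iff n M).1 hne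
  have := mag_le_top n σ
  linarith

/-- A non-zero vector of the sector `M` forces `−|Λ|n/2 ≤ M`. [folklore] -/
theorem neg_top_le_of_mem_ne_zero {M : ℝ} {ψ : TensorIndex Λ (n + 1) → ℂ}
    (hψ : ψ ∈ spinZSector (Λ := Λ) n M) (h0 : ψ ≠ 0) : -((Fintype.card Λ : ℝ) * n / 2) ≤ M := by
  have hne : spinZSector (Λ := Λ) n M ≠ ⊥ := by
    intro hbot
    rw [hbot, Submodule.mem_bot] at hψ
    exact h0 hψ
  obtain ⟨σ, hσ⟩ := (spinZSector_ne_bot_iff n M).1 hne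
  rw [← hσ]
  exact neg_top_le_mag n σ

/-! ### The induction step and the bound -/

/-- **Induction step.**  If `Re⟨φ, S⁺S⁻φ⟩ ≤ c‖φ‖²` on the sector `M + 1` with `c ≥ 0`, then
`Re⟨ψ, S⁺S⁻ψ⟩ ≤ (c + 2M)‖ψ‖²` on the sector `M` (`S⁺S⁻ = S⁻S⁺ + 2Sᶻ` and Cauchy–Schwarz for
`S⁻S⁺`).  Tasaki (2020) App. A.3. [folklore] -/
theorem raiseLower_form_step {M c : ℝ} (hc : 0 ≤ c)
    (hyp : ∀ φ ∈ spinZSector (Λ := Λ) n (M + 1),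
      (star φ ⬝ᵥ ((raiseOn n Finset.univ * lowerOn n Finset.univ) *ᵥ φ)).re ≤ c * (star φ ⬝ᵥ φ).re)
    {ψ : TensorIndex Λ (n + 1) → ℂ} (hψ : ψ ∈ spinZSector (Λ := Λ) n M) :
    (star ψ ⬝ᵥ ((raiseOn n Finset.univ * lowerOn n Finset.univ) *ᵥ ψ)).re ≤
      (c + 2 * M) * (star ψ ⬝ᵥ ψ).re := by
  have h := isSu2Triple_on n (Finset.univ : Finset Λ)
  set P := raiseOn n (Finset.univ : Finset Λ) with hP
  set L := lowerOn n (Finset.univ : Finset Λ) with hL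
  set Z := zOn n (Finset.univ : Finset Λ) with hZ
  have hZψ : Z *ᵥ ψ = (M : ℂ) • ψ := (mem_spinZSector_iff_mulVec n M ψ).1 hψ
  -- `φ = S⁺ψ ∈ 𝓗_{M+1}`
  have hφ : P *ᵥ ψ ∈ spinZSector (Λ := Λ) n (M + 1) := raiseOn_mulVec_mem n hψ
  -- `q = ⟨ψ, S⁻S⁺ψ⟩ = ‖S⁺ψ‖²`, `r = ‖S⁻S⁺ψ‖² = ⟨S⁺ψ, S⁺S⁻ S⁺ψ⟩`
  have hq : star (P *ᵥ ψ) ⬝ᵥ (P *ᵥ ψ) = star ψ ⬝ᵥ ((L * P) *ᵥ ψ) := by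
    rw [h.star_P_mulVec_dotProduct, mulVec_mulVec]
  have hr : star (P *ᵥ ψ) ⬝ᵥ ((P * L) *ᵥ (P *ᵥ ψ)) =
      star ((L * P) *ᵥ ψ) ⬝ᵥ ((L * P) *ᵥ ψ) := by
    simp only [← mulVec_mulVec]
    rw [h.star_M_mulVec_dotProduct]
  have hyp' := hyp (P *ᵥ ψ) hφ
  rw [hr, hq] at hyp'
  -- Cauchy–Schwarz: `(Re⟨ψ, Qψ⟩)² ≤ ‖ψ‖² ‖Qψ‖²`
  set q := (star ψ ⬝ᵥ ((L * P) *ᵥ ψ)).re with hqdef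
  have hCS := norm_star_dotProduct_sq_le ψ ((L * P) *ᵥ ψ)
  have hq_le : q ^ 2 ≤ (star ψ ⬝ᵥ ψ).re * (star ((L * P) *ᵥ ψ) ⬝ᵥ ((L * P) *ᵥ ψ)).re := by
    calc q ^ 2 ≤ ‖star ψ ⬝ᵥ ((L * P) *ᵥ ψ)‖ ^ 2 := by
          rw [hqdef, sq_le_sq, abs_norm]
          exact Complex.abs_re_le_norm _
      _ ≤ _ := hCS
  have hψψ : 0 ≤ (star ψ ⬝ᵥ ψ).re := (Complex.nonneg_iff.mp (dotProduct_star_self_nonneg ψ)).1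
  -- `q ≤ c ‖ψ‖²`
  have hqc : q ≤ c * (star ψ ⬝ᵥ ψ).re := by
    by_cases hq0 : q ≤ 0
    · exact le_trans hq0 (mul_nonneg hc hψψ)
    · rw [not_le] at hq0
      -- `q² ≤ ‖ψ‖² · r ≤ ‖ψ‖² · c · q`
      have h1 : q ^ 2 ≤ (star ψ ⬝ᵥ ψ).re * (c * q) :=
        le_trans hq_le (mul_le_mul_of_nonneg_left hyp' hψψ)
      nlinarith
  -- `⟨ψ, S⁺S⁻ψ⟩ = q + 2M‖ψ‖²`
  have hPL : P * L = L * P + (Z + Z) := h.PM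
  have hform : (star ψ ⬝ᵥ ((P * L) *ᵥ ψ)).re = q + 2 * M * (star ψ ⬝ᵥ ψ).re := by
    rw [hPL, add_mulVec, add_mulVec, hZψ, dotProduct_add, dotProduct_add, dotProduct_smul,
      Complex.add_re, Complex.add_re, smul_eq_mul, Complex.re_ofReal_mul, hqdef]
    ring
  rw [hform]
  nlinarith

/-- **`Re⟨ψ, S⁺_tot S⁻_tot ψ⟩ ≤ (S(S+1) − M(M−1)) ‖ψ‖²` on the sector `S^z_tot = M`**, `S = |Λ|n/2`
the top weight, for every weight `M = S − k`: the value on the top (`S_tot = S`) multiplet bounds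
the operator `S⁺S⁻` on the whole sector.  Tasaki (2020) §2.4, App. A.3; Tóth (1993). [folklore] -/
theorem raiseLower_form_le (k : ℕ) {M : ℝ} (hM : M = (Fintype.card Λ : ℝ) * n / 2 - k)
    {ψ : TensorIndex Λ (n + 1) → ℂ} (hψ : ψ ∈ spinZSector (Λ := Λ) n M) :
    (star ψ ⬝ᵥ ((raiseOn n Finset.univ * lowerOn n Finset.univ) *ᵥ ψ)).re ≤
      ((Fintype.card Λ : ℝ) * n / 2 * ((Fintype.card Λ : ℝ) * n / 2 + 1) - M * (M - 1)) *
        (star ψ ⬝ᵥ ψ).re := by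
  set S := (Fintype.card Λ : ℝ) * n / 2 with hS
  induction k generalizing M ψ with
  | zero =>
    -- top sector: `𝓗_{S+1} = ⊥`, so the hypothesis of the step holds with `c = 0`
    have htop : spinZSector (Λ := Λ) n (M + 1) = ⊥ :=
      spinZSector_eq_bot_of_top_lt n (by rw [hM]; push_cast; linarith)
    have hyp : ∀ φ ∈ spinZSector (Λ := Λ) n (M + 1),
        (star φ ⬝ᵥ ((raiseOn n Finset.univ * lowerOn n Finset.univ) *ᵥ φ)).re ≤
          0 * (star φ ⬝ᵥ φ).re := by
      intro φ hφ
      rw [htop, Submodule.mem_bot] at hφ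
      rw [hφ]
      simp
    have h := raiseLower_form_step n le_rfl hyp hψ
    have hval : (0 + 2 * M) = S * (S + 1) - M * (M - 1) := by
      rw [hM]; push_cast; ring
    rw [hval] at h
    exact h
  | succ k ih =>
    by_cases h0 : ψ = 0
    · rw [h0]
      simp
    -- the sector is non-trivial, so `−S ≤ M`, and the constant at `M + 1` is non-negative
    have hlow : -S ≤ M := neg_top_le_of_mem_ne_zero n hψ h0
    have hM1 : M + 1 = S - k := by rw [hM]; push_cast; ring
    have hc : 0 ≤ S * (S + 1) - (M + 1) * (M + 1 - 1) := by
      have hk : (0 : ℝ) ≤ k := Nat.cast_nonneg k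
      nlinarith
    have hyp : ∀ φ ∈ spinZSector (Λ := Λ) n (M + 1),
        (star φ ⬝ᵥ ((raiseOn n Finset.univ * lowerOn n Finset.univ) *ᵥ φ)).re ≤
          (S * (S + 1) - (M + 1) * (M + 1 - 1)) * (star φ ⬝ᵥ φ).re :=
      fun φ hφ => ih hφ hM1
    have h := raiseLower_form_step n hc hyp hψ
    have hval : S * (S + 1) - (M + 1) * (M + 1 - 1) + 2 * M = S * (S + 1) - M * (M - 1) := by ring
    rw [hval] at h
    exact h

/-! ### The route's currency: the `M × M` torus, `S^z_tot = 0` -/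

/-- **`Λ(ψ) ≤ S(S+1)`, `S = M²/2`** (crux `FerroSideChord`, stmt-19089): for even `M`, every unit
vector `ψ` of the `S^z_tot = 0` sector of the `M × M` torus has
`Re⟨ψ, S⁺_tot S⁻_tot ψ⟩ ≤ (M²/2)(M²/2 + 1)` — the exact ferromagnetic value (`FerroPointValue`):
the chord's right end is the maximum of the order parameter over the whole sector (Tóth 1993).
[folklore] -/
theorem lambda_le_ferroValue (M : ℕ) [NeZero M] (hE : Even M)
    (ψ : TensorIndex (TorusSite 2 M) 2 → ℂ) (hψ : ψ ∈ spinZSector (Λ := TorusSite 2 M) 1 0)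
    (h1 : star ψ ⬝ᵥ ψ = 1) :
    (star ψ ⬝ᵥ Matrix.mulVec ((∑ x : TorusSite 2 M, onSite x (spinRaise 1)) *
        (∑ y : TorusSite 2 M, onSite y (spinLower 1))) ψ).re ≤
      (M : ℝ) ^ 2 / 2 * ((M : ℝ) ^ 2 / 2 + 1) := by
  obtain ⟨m, hm⟩ := hE
  have hcard : (Fintype.card (TorusSite 2 M) : ℝ) = (M : ℝ) ^ 2 := by
    rw [Fintype.card_fun, ZMod.card, Fintype.card_fin]; push_cast; ring
  -- sector `0 = S − k` with `k = M²/2 = 2m²`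
  have hlabel : (0 : ℝ) = (Fintype.card (TorusSite 2 M) : ℝ) * (1 : ℕ) / 2 - ((2 * m ^ 2 : ℕ) : ℝ) := by
    rw [hcard, hm]; push_cast; ring
  have h := raiseLower_form_le (Λ := TorusSite 2 M) 1 (2 * m ^ 2) hlabel hψ
  rw [h1, Complex.one_re, mul_one, hcard] at h
  have hPL : (raiseOn 1 (Finset.univ : Finset (TorusSite 2 M)) * lowerOn 1 Finset.univ) =
      ((∑ x : TorusSite 2 M, onSite x (spinRaise 1)) *
        (∑ y : TorusSite 2 M, onSite y (spinLower 1))) := rfl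
  rw [hPL] at h
  have hs : (M : ℝ) ^ 2 * ((1 : ℕ) : ℝ) / 2 = (M : ℝ) ^ 2 / 2 := by push_cast; ring
  rw [hs] at h
  linarith

/-- **Right-end slice `Δ₂ = 1` of the registered stub `stub_monotoneFM`** (line `fm-monotone-anchor`
of crux `FerroSideChord`, stmt-19089), in the stub's binder shape, GIVEN the route item
`FerroPointValue` (PROVED: `Theorems.AnisotropyChord.ferroPointValue_proof`; taken by name): for
even `M ≥ 4`, `0 ≤ Δ₁ ≤ 1`, a normalised sector ground state `ψ₁` of `H_M(Δ₁)` and a normalised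
sector ground state `ψ₂` of the isotropic ferromagnet `H_M(1)`: `Λ(ψ₁) ≤ Λ(ψ₂) = S(S+1)`.
The interior content `Δ₂ < 1` of the stub remains open. [folklore] -/
theorem monotoneFM_right_end (hFPV : FerroPointValue) :
    ∀ (M : ℕ) [NeZero M], Even M → 4 ≤ M → ∀ (Δ₁ : ℝ), 0 ≤ Δ₁ → Δ₁ ≤ 1 →
      ∀ (ψ₁ ψ₂ : TensorIndex (TorusSite 2 M) 2 → ℂ),
      ψ₁ ∈ spinZSector (Λ := TorusSite 2 M) 1 0 → star ψ₁ ⬝ᵥ ψ₁ = 1 →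
      Matrix.mulVec (xxzHamiltonian 1 (torusGraph 2 M) (-1) Δ₁) ψ₁ =
        ((lowestEnergyInSector 1 (xxzHamiltonian 1 (torusGraph 2 M) (-1) Δ₁) 0 : ℝ) : ℂ) • ψ₁ →
      ψ₂ ∈ spinZSector (Λ := TorusSite 2 M) 1 0 → star ψ₂ ⬝ᵥ ψ₂ = 1 →
      Matrix.mulVec (xxzHamiltonian 1 (torusGraph 2 M) (-1) 1) ψ₂ =
        ((lowestEnergyInSector 1 (xxzHamiltonian 1 (torusGraph 2 M) (-1) 1) 0 : ℝ) : ℂ) • ψ₂ →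
      (star ψ₁ ⬝ᵥ Matrix.mulVec ((∑ x : TorusSite 2 M, onSite x (spinRaise 1)) *
          (∑ y : TorusSite 2 M, onSite y (spinLower 1))) ψ₁).re ≤
        (star ψ₂ ⬝ᵥ Matrix.mulVec ((∑ x : TorusSite 2 M, onSite x (spinRaise 1)) *
          (∑ y : TorusSite 2 M, onSite y (spinLower 1))) ψ₂).re := by
  intro M _ hE _h4 Δ₁ _h0 _h1 ψ₁ ψ₂ h₁K h₁1 _h₁H h₂K h₂1 h₂H
  rw [hFPV M hE ψ₂ h₂K h₂1 h₂H]
  exact lambda_le_ferroValue M hE ψ₁ h₁K h₁1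

end Summit.HubbardSuperconductivity.HubbardSuperconductivity.Theorems.AnisotropyChord.FerroSide

end
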